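import Summits.NavierStokesRegularity.NavierStokesRegularity.Theorems.AdaptedFrequencyAdaptedKernelExistsLowerOfUpperBridge

/-!
# Crux `AdaptedKernelExists` (stmt-NavierStokesRegularity-2956), line `nash-entropy-last-block`:
  NONNEGATIVITY AND STRICT POSITIVITY for STUB `stub_prekernelBounds`

Helper file (lands `--supports stmt-NavierStokesRegularity-2956`) for the registered stub
`stub_prekernelBounds` of the line's skeleton (positivity and the upper comparison for the smooth
representative `g` of `Γ + w`). The inputs are abstract: a function `G : ℝ → E → ℝ` on a block
`[t, t₁]` whose reversed rescaled version `v(σ) = G(t₁ − σ/ν)` lies in the tree's local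
drift–heat class `IsDriftHeatSolutionOn a v A (Icc 0 (ν(t₁ − t))) univ` (`DriftHeatLocalClass`).
For a general finite-dimensional inner product space `E`:

* `prekernel_nonneg_of_decay`: if `G(t₁, ·) ≥ 0` and `G ≥ −δ` far from `x₀` uniformly on the
  block (for every `δ > 0`), then `G ≥ 0` on `[t, t₁] × E` — the tree's comparison principle
  `IsDriftHeatSolutionOn.paraboloid_comparison` on the straight cylinders `[0, ν(t₁ − t)] ×
  B̄(x₀, ρ)` with the constant barrier `−ε`, `ρ → ∞`, `ε → 0`;
* `prekernel_pos_of_nonneg`: if moreover `A ≥ 0`, `G ≥ 0` on the block and the top slice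
  `G(t₁, ·)` is continuous with `G(t₁, x₀) > 0`, then `G(t, ·) > 0` — the tree's Gaussian lower
  bound by the earlier local mass `IsDriftHeatSolutionOn.kernel_lower_bound` with the weight
  `ψ · G(t₁)` (`ψ` a bump of `B̄(x₀, 1) ⊂ B̄(x₀, 2)`) on the balls `B̄(x₀, ρ′)`, `ρ′ → ∞`
  (the argument of `lowerOfUpper_pointwise`), and `kSubLow > 0`.

Its `ℝ³` form `stub_prekernelBounds_positivity` is a registered sub-goal of the crux item.
-/

noncomputable section

open MeasureTheory Set Filter Topology Metric Function Real
open scoped Laplacian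
open Literature.Analysis.FluidPDE Literature.Analysis.UnboundedOperators

namespace Summit.NavierStokesRegularity.NavierStokesRegularity.Theorems.AdaptedKernelExists.NashEntropyLastBlock

section General

variable {E : Type*} [NormedAddCommGroup E] [InnerProductSpace ℝ E] [FiniteDimensional ℝ E]
  [MeasurableSpace E] [BorelSpace E]

/-- **Nonnegativity from the decay.** Let `v(σ) = G(t₁ − σ/ν)` be in the local drift–heat class
on `[0, ν(t₁ − t)] × E` (`ν > 0`), `G(t₁, ·) ≥ 0`, and suppose that for every `δ > 0`
there is `ρ₀` with `−δ ≤ G(s, y)` for `s ∈ [t, t₁]`, `‖y − x₀‖ ≥ ρ₀`. Then `G ≥ 0` on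
`[t, t₁] × E`: the constant barrier `−ε` is a classical (sub)solution below `v` at the bottom
(`G(t₁) ≥ 0`) and on the side of the cylinder `[0, ν(t₁ − t)] × B̄(x₀, ρ)`, `ρ ≥ ρ₀(ε)`, so
`paraboloid_comparison` gives `−ε ≤ v` inside; `ρ → ∞`, `ε → 0`. -/
theorem prekernel_nonneg_of_decay {ν t t₁ A : ℝ} {x₀ : E} {G : ℝ → E → ℝ} {a : ℝ → E → E}
    (hν : 0 < ν)
    (hv : IsDriftHeatSolutionOn a (fun σ => G (t₁ - σ / ν)) A (Icc 0 (ν * (t₁ - t))) univ)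
    (hbot : ∀ z, 0 ≤ G t₁ z)
    (hdecay : ∀ δ : ℝ, 0 < δ → ∃ ρ₀ : ℝ, ∀ s ∈ Icc t t₁, ∀ y, ρ₀ ≤ ‖y - x₀‖ → -δ ≤ G s y) :
    ∀ s ∈ Icc t t₁, ∀ x, 0 ≤ G s x := by
  have hmem : ∀ σ ∈ Icc 0 (ν * (t₁ - t)), t₁ - σ / ν ∈ Icc t t₁ := fun σ hσ => by
    have h1 : 0 ≤ σ / ν := div_nonneg hσ.1 hν.le
    have h2 : σ / ν ≤ t₁ - t := by rw [div_le_iff₀ hν]; linarith [hσ.2]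
    exact ⟨by linarith, by linarith⟩
  intro s hs x
  have main : ∀ ε : ℝ, 0 < ε → -ε ≤ G s x := by
    intro ε hε
    obtain ⟨ρ₀, hρ₀⟩ := hdecay ε hε
    obtain ⟨ρ, hρ⟩ : ∃ ρ : ℝ, ρ = max ρ₀ ‖x - x₀‖ + 1 := ⟨_, rfl⟩
    have hρx : ‖x - x₀‖ ≤ ρ := by rw [hρ]; linarith [le_max_right ρ₀ ‖x - x₀‖]
    have hρρ₀ : ρ₀ ≤ ρ := by rw [hρ]; linarith [le_max_left ρ₀ ‖x - x₀‖]
    have hρ0 : 0 < ρ := by rw [hρ]; linarith [le_max_right ρ₀ ‖x - x₀‖, norm_nonneg (x - x₀)]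
    have hD : ∀ y : E, fderiv ℝ (fun _ : E => -ε) y = 0 := fun y => fderiv_const_apply _
    have hL : ∀ y : E, (Δ fun _ : E => -ε) y = 0 := fun y => by
      rw [InnerProductSpace.laplacian_const]; rfl
    have key := hv.paraboloid_comparison (c := x₀) (t_b := 0) (t_T := ν * (t₁ - t))
      (P := fun _ => ρ ^ 2) (φ := fun _ _ => -ε) (φt := fun _ _ => 0)
      isOpen_univ Subset.rfl continuous_const (fun _ _ _ _ => mem_univ _)
      continuousOn_const (fun _ _ => contDiff_const)
      (fun _ τ _ => hasDerivAt_const τ (-ε))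
      (fun _ => continuousOn_const) (fun _ => continuousOn_const) (fun _ => continuousOn_const)
      (fun τ _ y _ => by rw [hD, hL, norm_zero, mul_zero, sub_zero])
      (fun y _ => by
        show -ε ≤ G (t₁ - 0 / ν) y
        rw [zero_div, sub_zero]
        linarith [hbot y])
      (fun σ hσ y hy => by
        have hyρ : ‖y - x₀‖ = ρ := (pow_left_inj₀ (norm_nonneg _) hρ0.le two_ne_zero).1 hy
        show -ε ≤ G (t₁ - σ / ν) y
        exact hρ₀ _ (hmem σ hσ) y (by rw [hyρ]; exact hρρ₀))
    have hσs : ν * (t₁ - s) ∈ Icc 0 (ν * (t₁ - t)) :=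
      ⟨mul_nonneg hν.le (by linarith [hs.2]),
        mul_le_mul_of_nonneg_left (by linarith [hs.1]) hν.le⟩
    have h := key (ν * (t₁ - s)) hσs x (pow_le_pow_left₀ (norm_nonneg _) hρx 2)
    have e1 : t₁ - ν * (t₁ - s) / ν = s := by field_simp; ring
    beta_reduce at h
    rwa [e1] at h
  by_contra hneg
  have hlt : G s x < 0 := lt_of_not_ge hneg
  have := main (-G s x / 2) (by linarith)
  linarith

/-- **Strict positivity from nonnegativity.** Let `v(σ) = G(t₁ − σ/ν)` be in the local
drift–heat class on `[0, ν(t₁ − t)] × E` with drift bound `A ≥ 0` (`t < t₁`, `ν > 0`), `G ≥ 0` on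
`[t, t₁] × E`, and let the top slice `G(t₁, ·)` be continuous with `G(t₁, x₀) > 0`. Then
`G(t, x) > 0` for every `x`: with the continuous weight `φ = ψ · G(t₁)` (`ψ` a bump of
`B̄(x₀, 1) ⊂ B̄(x₀, 2)`, so `0 ≤ φ ≤ G(t₁)`, `∫ φ > 0`), the tree's
`IsDriftHeatSolutionOn.kernel_lower_bound` on the balls `B̄(x₀, ρ′)` (nonnegativity of `G` on
their boundary) gives in the limit `ρ′ → ∞`
`(∫ φ) · kSubLow n A (‖x − x₀‖ + 2) (ν(t₁ − t)) ≤ G(t, x)`, and `kSubLow > 0`. -/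
theorem prekernel_pos_of_nonneg {ν t t₁ A : ℝ} {x₀ : E} {G : ℝ → E → ℝ} {a : ℝ → E → E}
    (hν : 0 < ν) (htt₁ : t < t₁) (hA : 0 ≤ A)
    (hv : IsDriftHeatSolutionOn a (fun σ => G (t₁ - σ / ν)) A (Icc 0 (ν * (t₁ - t))) univ)
    (hnn : ∀ s ∈ Icc t t₁, ∀ x, 0 ≤ G s x)
    (hGc : Continuous (G t₁)) (hGx₀ : 0 < G t₁ x₀) (x : E) : 0 < G t x := by
  have hmem : ∀ σ ∈ Icc 0 (ν * (t₁ - t)), t₁ - σ / ν ∈ Icc t t₁ := fun σ hσ => by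
    have h1 : 0 ≤ σ / ν := div_nonneg hσ.1 hν.le
    have h2 : σ / ν ≤ t₁ - t := by rw [div_le_iff₀ hν]; linarith [hσ.2]
    exact ⟨by linarith, by linarith⟩
  have hστ : 0 < ν * (t₁ - t) := mul_pos hν (by linarith)
  have ht₁ : t₁ ∈ Icc t t₁ := right_mem_Icc.2 htt₁.le
  -- the weight `φ = ψ · G(t₁)`
  let ψ : ContDiffBump x₀ := ⟨1, 2, one_pos, by norm_num⟩
  obtain ⟨φ, hφ⟩ : ∃ φ : E → ℝ, φ = fun z => ψ z * G t₁ z := ⟨_, rfl⟩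
  have hφc : Continuous φ := by rw [hφ]; exact ψ.continuous.mul hGc
  have h0 : ∀ z, 0 ≤ φ z := fun z => by rw [hφ]; exact mul_nonneg ψ.nonneg (hnn t₁ ht₁ z)
  have hφG : ∀ z, φ z ≤ G t₁ z := fun z => by
    rw [hφ]
    calc ψ z * G t₁ z ≤ 1 * G t₁ z := mul_le_mul_of_nonneg_right ψ.le_one (hnn t₁ ht₁ z)
      _ = G t₁ z := one_mul _
  have hsupp : tsupport φ ⊆ closedBall x₀ 2 := by
    rw [← ψ.tsupport_eq, hφ]; exact tsupport_mul_subset_left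
  have hφs : HasCompactSupport φ :=
    (isCompact_closedBall x₀ 2).of_isClosed_subset (isClosed_tsupport φ) hsupp
  have hmass : 0 < ∫ z, φ z := by
    refine hφc.integral_pos_of_hasCompactSupport_nonneg_nonzero hφs (fun z => h0 z) (x := x₀) ?_
    rw [hφ]
    simp only [ψ.one_of_mem_closedBall (mem_closedBall_self one_pos.le), one_mul]
    exact hGx₀.ne'
  -- comparison on the balls `B̄(x₀, ρ′)`
  have e1 : t₁ - ν * (t₁ - t) / ν = t := by field_simp; ring
  have hev : ∀ᶠ ρ' in atTop, (∫ z, φ z) *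
      (kSubLow (Module.finrank ℝ E) A (‖x - x₀‖ + 2) (ν * (t₁ - t)) -
        gaussTail (Module.finrank ℝ E) (ρ' - 2) (ν * (t₁ - t))) ≤ G t x := by
    filter_upwards [eventually_ge_atTop (max ‖x - x₀‖ (2 + 2 * (Module.finrank ℝ E : ℝ) *
      (ν * (t₁ - t)) + 1))] with ρ' hρ'
    have h1 : ‖x - x₀‖ ≤ ρ' := (le_max_left _ _).trans hρ'
    have h2 : 2 + 2 * (Module.finrank ℝ E : ℝ) * (ν * (t₁ - t)) + 1 ≤ ρ' :=
      (le_max_right _ _).trans hρ'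
    have hNσ : 0 ≤ 2 * (Module.finrank ℝ E : ℝ) * (ν * (t₁ - t)) := by positivity
    have hd1 : 1 ≤ ρ' - 2 := by linarith
    have hrsρ : (2:ℝ) < ρ' := by linarith
    have hroom : 2 * (Module.finrank ℝ E : ℝ) * (ν * (t₁ - t) - 0) < (ρ' - 2) ^ 2 := by
      have : ρ' - 2 ≤ (ρ' - 2) ^ 2 := by nlinarith
      rw [sub_zero]
      linarith
    have key := hv.kernel_lower_bound isOpen_univ hA (c := x₀) two_pos hrsρ h1 Subset.rfl
      (subset_univ _) hroom (fun σ hσ z _ => hnn _ (hmem σ hσ) z) hφc h0 hsupp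
      (fun z _ => by
        show φ z ≤ G (t₁ - 0 / ν) z
        rw [zero_div, sub_zero]
        exact hφG z)
      (ν * (t₁ - t)) ⟨hστ, le_rfl⟩ x (mem_closedBall.2 (by rw [dist_eq_norm]))
    simpa only [sub_zero, e1] using key
  -- the limit `ρ′ → ∞`
  have hg : Tendsto (fun ρ' : ℝ => gaussTail (Module.finrank ℝ E) (ρ' - 2) (ν * (t₁ - t))) atTop
      (𝓝 0) := by
    have h1 : Tendsto (fun ρ' : ℝ => ρ' - 2) atTop atTop :=
      tendsto_atTop_atTop.2 fun c => ⟨c + 2, fun a ha => by linarith⟩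
    have h2 : Tendsto (fun d : ℝ => Real.exp (-d ^ 2 / (4 * (ν * (t₁ - t))))) atTop (𝓝 0) := by
      refine Real.tendsto_exp_atBot.comp ?_
      exact (tendsto_neg_atTop_atBot.comp (tendsto_pow_atTop two_ne_zero)).atBot_div_const
        (by positivity)
    have h3 : Tendsto (fun d : ℝ => gaussTail (Module.finrank ℝ E) d (ν * (t₁ - t))) atTop
        (𝓝 0) := by
      have := h2.const_mul ((4 * π * (ν * (t₁ - t))) ^ (-(Module.finrank ℝ E : ℝ) / 2))
      rw [mul_zero] at this
      exact this
    exact h3.comp h1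
  have hlim := (tendsto_const_nhds (x := ∫ z, φ z)).mul
    ((tendsto_const_nhds (x := kSubLow (Module.finrank ℝ E) A (‖x - x₀‖ + 2)
      (ν * (t₁ - t)))).sub hg)
  have hle := le_of_tendsto hlim hev
  simp only [sub_zero] at hle
  have hk : 0 < kSubLow (Module.finrank ℝ E) A (‖x - x₀‖ + 2) (ν * (t₁ - t)) :=
    kSubLow_pos _ _ _ hστ
  have := mul_pos hmass hk
  linarith

end General

/-! ### The registered sub-goal (dimension three) -/

/-- **Registered sub-goal `stub_prekernelBounds_positivity`** (the `ℝ³` form of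
`prekernel_pos_of_nonneg`, the strict-positivity step of STUB `stub_prekernelBounds`): if the
reversed rescaled `v(σ) = G(t₁ − σ/ν)` is in the local drift–heat class on `[0, ν(t₁ − t)]` with
drift bound `A ≥ 0`, `G ≥ 0` on the block `[t, t₁]`, and the top slice `G(t₁, ·)` is continuous and
positive at `x₀`, then `G(t, ·) > 0`. -/
theorem stub_prekernelBounds_positivity :
    ∀ (ν t t₁ A : ℝ) (x₀ : EuclideanSpace ℝ (Fin 3)) (G : ℝ → EuclideanSpace ℝ (Fin 3) → ℝ) (a : ℝ → EuclideanSpace ℝ (Fin 3) → EuclideanSpace ℝ (Fin 3)), 0 < ν → t < t₁ → 0 ≤ A → IsDriftHeatSolutionOn a (fun σ => G (t₁ - σ / ν)) A (Icc 0 (ν * (t₁ - t))) univ → (∀ s ∈ Icc t t₁, ∀ x, 0 ≤ G s x) → Continuous (G t₁) → 0 < G t₁ x₀ → ∀ x : EuclideanSpace ℝ (Fin 3), 0 < G t x :=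
  fun _ _ _ _ _ _ _ hν htt₁ hA hv hnn hGc hGx₀ x => prekernel_pos_of_nonneg hν htt₁ hA hv hnn hGc hGx₀ x

end Summit.NavierStokesRegularity.NavierStokesRegularity.Theorems.AdaptedKernelExists.NashEntropyLastBlock

end
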